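import Mathlib
import Summits.KontsevichZagierPeriods.Zeta5Search.LemmaDBonus
import Summits.KontsevichZagierPeriods.Zeta5Search.SecondOrderDigit
import HarnessLib

/-!
# ζ(5) search — STATEMENT FILE: the CONJUGATE-RAISE LAW (candidate class law `casLB + 2`, the odd companion of law A3) — DENOM-LAW prover-d1 gen 2

HONEST FRAMING: systematic search; no irrationality claim unless certified.  Cell `pub-zeta5`, track «DENOM-LAW», seat `denom-prover-d1`
gen 2 (ATTEMPT-3 §4e).  ONE `Prop`, tagged `@[conjecture]`: a CANDIDATE digit-free class law for the contiguity Casoratian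
`Cas_j(b) = W(b+e_j)V(b) − W(b)V(b+e_j)` (`CasoratianValuation.casoratian`), minted by this seat from exact data, in the vocabulary of
`ClusterValuation*` / `LemmaDBonus` / `SecondOrderDigit`; NOT proved here (no theorem, no `sorry`).  It is a statement about p-adic
valuations of explicit rationals; nothing about ζ(5); every model exponent it could feed is `< 1`; records in print UNMOVED.

WHERE IT COMES FROM.  The tree's bonus rungs above THEOREM LB (`casLB`) are: the Lemma-D bonus `casLB + 1` (one live minimal type; rung J /
collinearity O), the double-drop bonus `casLB + 2` (minimal exponent `−N` even, minimal classes tame singles or centre-free palindromes; rung B),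
law A3 `casLB + 3` (`SecondOrder.LawA3`: `M` even, deep classes of ONE palindromic type, sub-deep classes single raises; rung I) and C2*.
On the census's A/B family the top rule-R2 cell `(t+2)n < p ≤ (t+3)n` (`DenomLaw.RuleR2ABTopCell`, statement file `RuleRABFamily.lean`) has
minimal exponent `m = −9` (ODD `M`), attained by ONE CONJUGATE PAIR of classes with exponent vectors `T = [1,−5,−6,1]` and `reverse T`, the
sub-minimal classes `[1,−4,−6,1]`, `[1,−6,−4,1]` being single raises of `T`, `reverse T` (this is the picture at `n = 1`; for `n ≥ 2` the
cell carries several deep pairs of the same two types AND sub-minimal 3-point classes `[0,−6,−2]` / `[−2,−6,0]` that are not raises of `T`,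
so hypothesis (H2) below fails there: the law below covers the A/B top cell at `n = 1` only, and `RuleR2ABTopCell` — `+2` OBSERVED at every
`n` — stays a separate statement); there Lemma D gives `−14` (PROVED, `RuleRAB.cell2`) and the truth is `−13 = casLB + 2`.  Sampling random
parameter vectors shows that this is a general phenomenon exactly when `T` differs from its reverse by MOVING ONE UNIT
(`T − reverse T = e_i − e_k`) and the sub-minimal pole classes are raises of `T` (or tame singles): the law below.

EVIDENCE (exact rational arithmetic, gen-1 dual-series engine `HOME/code/gen1/dictionary.py`; class data by g0's validated port
`classfast.py`; seat scripts `HOME/denom-law/prover-d1/g2/code/lawCR_test.py`, `lawA3odd_test.py`):  IN SAMPLE (random sorted polytope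
vectors `b₀ ≤ 120`, window primes `p < 48`, `j = 7`, exactly two deep classes): 3,515 cells satisfying the hypotheses, **0 violations**,
equality `v = casLB + 2` at 2,020 (57 %), slack `+1` at 1,267, `+2…+7` at 228, 93 distinct deep types `T`; the type-wise form stated below
(any number of deep classes, 2–36 observed, incl. ray-like vectors `b₀ ≤ 170`, `p < 60`): 920 cells, 0 violations, 55 % tight
(`g2/code/h2_refine.py`: with sub-minimal multipole classes that are NOT raises of `T` present, the value drops to `casLB + 1` in 164/216 +
86/100 cells — (H2) is sharp as a type condition).  BOTH extra clauses are load-bearing: with `T − reverse T` of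
sup-norm `≥ 2` the value is `casLB + 1` at ≈ 80 % of cells (e.g. `b = (18; 9,8,7,6,3,3,1)`, `p = 7`, `T = [0,−5,−2]`); with asymmetry `1` at
TWO level pairs (e.g. `T = [0,−2,−5,−3,−1]`) 3 failures; without the raise clause on the sub-deep classes 605/818 fail.  OUT OF SAMPLE:
pre-registration `HOME/denom-law/prover-d1/g2/prereg/PREREG-CR-LAW.json` (sha256 `a8d124fcdf6e2dbc…`, sealed in HOME/INBOX 2026-08-23T06:28Z
BEFORE the job) → kit job `j186468` (`lawcr`, exact, `b₀ ≤ 240`, `p < 110`, `j = 7` and a second admissible `j` per cell; it tests the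
sub-case with exactly one deep pair); its score is posted in HOME/INBOX and `HOME/denom-law/prover-d1/ATTEMPT-3.md` §4e.  ON THE CENSUS
RAYS (class-data scan `g2/code/cr_census_scan.py`, `n ≤ 12`): the hypotheses hold — with value `casLB + 2` ONE ABOVE the best proved rung
(M/J/B/Y/I) every time — on the A/B top cells (A14/A18/B20, most `(n, p)`), on the B20 octave cell `θ ∈ (9.7, 9.9)` (`T = [1,1,−5,−6,−6,1,1]`),
on TOP_STAIR #7/#8/#9 and X1 windows with `T = [1,−5,−6,1]` (e.g. X1 `(17.1n, 17.9n)`, where the landed atlas `X1CellX` proves `−14`), and on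
isolated deep cells of TS2/TS4/TS7/TS10/flag with long types; exact spot checks (X1 n=3 p=53, TS8 n=2 p=19, TS9 n=3 p=23, TS7 n=2 p=37,
B20 n=10 p=97, A14 n=4 p=53): truth = `casLB + 2` EXACTLY in all six.  Falsifier: one cell satisfying the hypotheses with `v_p(Cas_j) ≤ casLB + 1`.  A proof would follow the tree's second-order machine (`SecondOrderDigit` (W2)/(V2), `SecondOrderCollinearityProof`,
`LemmaDBonusProof`): the `p^{3+2m}` digit vanishes by Lemma D, and the `p^{4+2m}` digit is the sum of the second digits of the deep
conjugate pair and the first digits of its raises — on the A/B top cell this is the OBSERVED second-order family-ratio law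
`v(W_M(b⁺)/W_M(b) − V_M(b⁺)/V_M(b)) = 2` for the deep pair aggregates (ATTEMPT-3 §4).
-/

namespace Summit.KontsevichZagierPeriods.Zeta5Search.DenomLaw

open Finset
open Summit.KontsevichZagierPeriods.Zeta5Search.CasoratianValuation (InPolytope shift casoratian)
open Summit.KontsevichZagierPeriods.Zeta5Search.WedgeDictionary (dOf)
open Summit.KontsevichZagierPeriods.Zeta5Search.ClusterValuation
  (classExp classPoleCount classNu tameSingle CentreIn casLB multipoleClasses expVector)
open Summit.KontsevichZagierPeriods.Zeta5Search.SecondOrder (isRaise)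

/-- (Boolean test.) `T` differs from its reverse by MOVING ONE UNIT: the entrywise difference `T − reverse T` has exactly one entry `+1`,
exactly one entry `−1`, and zeros elsewhere (so `T` is not palindromic, and its asymmetry has sup-norm `1` at a single level pair). -/
def unitMoved (T : List ℤ) : Bool :=
  let d := List.zipWith (· - ·) T T.reverse
  decide ((d.filter (· ≠ 0)).length = 2) && decide ((d.filter (· = 1)).length = 1) && decide ((d.filter (· = -1)).length = 1)

/-- Sanity: the A/B top-cell type `[1,−5,−6,1]` moves one unit; `[0,−5,−2]` (asymmetry 2) and `[0,−2,−5,−3,−1]` (two level pairs) do not;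
a palindrome does not. -/
example : unitMoved [1, -5, -6, 1] = true ∧ unitMoved [-3, -4] = true ∧ unitMoved [0, -5, -2] = false ∧
    unitMoved [0, -2, -5, -3, -1] = false ∧ unitMoved [1, -6, -6, 1] = false := by decide

/-- **THE CONJUGATE-RAISE LAW (CANDIDATE, OBSERVED; the odd companion of law A3).**  In the window `5 ≤ p ≤ b₀ < p² − 2`, `p ≤ d(b)`,
let `m` be the least class exponent among the multipole classes, with `m` ODD and `m ≤ −7`.  Suppose there is an exponent vector `T`
moving one unit (`unitMoved T`) such that (H1) every multipole class of exponent `m` is not self-conjugate and has exponent vector `T` or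
`reverse T`; (H2) every pole class of exponent `m + 1` is either a multipole class whose exponent vector is a single raise
(`SecondOrder.isRaise`) of `T` or of `reverse T`, or a tame single-pole class (then `ν ≥ 0`); (H0) every single-pole class has `ν ≥ m + 1`.
Then `v_p(Cas_j(b)) ≥ casLB(b,p) + 2` (`= 2m + 5`).  [Lemma D gives `casLB + 1` under (H1)+(H0); exact evidence in the module docstring:
3,515 + 920 in-sample cells, 0 violations, 57 % tight; out-of-sample kit j186468 pre-registered.] -/
@[conjecture] def ConjugateRaiseLaw : Prop :=
  ∀ (b : ℕ → ℤ) (j p : ℕ) (m : ℤ) (T : List ℤ), InPolytope b → 1 ≤ j → j ≤ 7 → InPolytope (shift b j) →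
    p.Prime → 5 ≤ p → (p : ℤ) ≤ b 0 → (p : ℤ) ≤ dOf b → (b 0 + 2 : ℤ) < (p : ℤ) ^ 2 →
    Odd m → m ≤ -7 →
    (∃ x ∈ multipoleClasses b p, classExp b p x = m) →
    (∀ x ∈ multipoleClasses b p, m ≤ classExp b p x) →
    unitMoved T = true →
    (∀ x ∈ multipoleClasses b p, classExp b p x = m →
        ¬ CentreIn b p x ∧ (expVector b p x = T ∨ expVector b p x = T.reverse)) →
    (∀ y, y < p → 1 ≤ classPoleCount b p y → classExp b p y = m + 1 →
        (2 ≤ classPoleCount b p y ∧ (isRaise T (expVector b p y) = true ∨ isRaise T.reverse (expVector b p y) = true)) ∨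
        (classPoleCount b p y = 1 ∧ tameSingle b p y = true)) →
    (∀ y, y < p → classPoleCount b p y = 1 → m + 1 ≤ classNu b p y) →
    casoratian b j ≠ 0 → casLB b p + 2 ≤ padicValRat p (casoratian b j)

end Summit.KontsevichZagierPeriods.Zeta5Search.DenomLaw
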